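import Mathlib.Analysis.SpecialFunctions.Pow.Real
import Mathlib.Order.Filter.AtTopBot.Basic
import HarnessLib

/-!
# Weighted far-cone bookkeeping: the `m = 0` remainder budget vanishes on hyperbolic pairs

A brick for the rates block of crux `EIHFluxBalance.ModulatedKerrHandoff` (H′, stmt-FinalStateConjecture-17402),
mechanism card `soft-era-tube-lift` (Cruxes/ModulatedKerrHandoff/Ideas/soft-era-tube-lift.md; triage r2-1
§sharpen (1), strategist census R4): once the far-cone retardation remainder of ONE hole is bounded by
`C·M·(A + A₃·d)` (`SoftEraTubeLift.FarConeRetardationRemainder`, open, size L) and the EIH accelerations of a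
pair at separation `D(t)` obey `A ≍ M'/D(t)²`, `A₃ ≍ M'/D(t)³`, the `(1 + d^{7/4})`-weighted remainder of the
handoff's `m = 0` cone clause is `(1 + d^{7/4})·M M'·(1/D(t)² + d/D(t)³)` on the cone `d ≤ κ t`.  If the pair
separates LINEARLY, `D(t) ≥ σ t`, this is `O(t^{-1/4})` uniformly on the cone, hence eventually below every
`ε > 0`.  That arithmetic — `SoftEraTubeLift.WeightedRemainderVanishes` of the r2 sketch
`Cruxes/ModulatedKerrHandoff/SketchIdeator5r2.lean` (l. 286), VERBATIM (`d^{7/4}` written `√(√(d^7))`) — is proved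
here with an explicit threshold: with `K := M M' (1/σ² + κ/σ³) + 1`, every
`t ≥ max 1 (max (2K/ε) (κ^7 (2K/ε)^4))` works (the weight is handled through `√(√y) ≤ z ⇔ y ≤ z⁴`, no real powers).
For parabolic pairs (`D ~ t^{2/3}`) the same budget DIVERGES like `t^{5/12}` (Disproof §9 item 10′); nothing here
speaks to that case.

[folklore] — pure real analysis; no source beyond the card.
-/

noncomputable section

-- the doubled `FinalStateConjecture` path component is the summit/problem naming scheme
set_option linter.dupNamespace false

open Filter Set

namespace Summit.FinalStateConjecture.FinalStateConjecture.Theorems.EIHFluxBalance.ModulatedKerrHandoffBricks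

/-- `√(√y) ≤ z` as soon as `y ≤ z ^ 4` and `0 ≤ z` (monotonicity of `√` twice and `√(√(z⁴)) = z`). -/
theorem sqrt_sqrt_le_of_le_pow_four {y z : ℝ} (hz : 0 ≤ z) (h : y ≤ z ^ 4) :
    Real.sqrt (Real.sqrt y) ≤ z := by
  have h4 : z ^ 4 = (z ^ 2) ^ 2 := by ring
  calc Real.sqrt (Real.sqrt y) ≤ Real.sqrt (Real.sqrt (z ^ 4)) :=
        Real.sqrt_le_sqrt (Real.sqrt_le_sqrt h)
    _ = z := by rw [h4, Real.sqrt_sq (sq_nonneg z), Real.sqrt_sq hz]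

/-- The unweighted per-hole remainder on the cone `d ≤ κ t` under linear separation `D = σ t`:
`M M' (1/(σt)² + d/(σt)³) ≤ M M' (1/σ² + κ/σ³) / t²` for `t > 0`. -/
theorem remainder_le_div_sq {M M' σ κ t d : ℝ} (hM : 0 ≤ M) (hM' : 0 ≤ M') (hσ : 0 < σ)
    (ht : 0 < t) (hd0 : 0 ≤ d) (hd : d ≤ κ * t) :
    M * M' * (1 / (σ * t) ^ 2 + d / (σ * t) ^ 3) ≤ M * M' * (1 / σ ^ 2 + κ / σ ^ 3) / t ^ 2 := by
  have hσt : 0 < σ * t := mul_pos hσ ht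
  have hκ : 0 ≤ κ := by
    by_contra hneg
    have : κ * t < 0 := mul_neg_of_neg_of_pos (lt_of_not_ge hneg) ht
    linarith
  have h1 : 1 / (σ * t) ^ 2 = (1 / σ ^ 2) / t ^ 2 := by
    field_simp
  have h2 : d / (σ * t) ^ 3 ≤ (κ / σ ^ 3) / t ^ 2 := by
    have h2' : (κ / σ ^ 3) / t ^ 2 = (κ * t) / (σ * t) ^ 3 := by
      field_simp
    rw [h2']
    exact div_le_div_of_nonneg_right hd (by positivity)
  calc M * M' * (1 / (σ * t) ^ 2 + d / (σ * t) ^ 3)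
      ≤ M * M' * ((1 / σ ^ 2) / t ^ 2 + (κ / σ ^ 3) / t ^ 2) := by
        rw [h1]
        exact mul_le_mul_of_nonneg_left (by linarith) (mul_nonneg hM hM')
    _ = M * M' * (1 / σ ^ 2 + κ / σ ^ 3) / t ^ 2 := by ring

/-- **Weighted far-cone bookkeeping** (`SoftEraTubeLift.WeightedRemainderVanishes` of
`Cruxes/ModulatedKerrHandoff/SketchIdeator5r2.lean`, verbatim): if a pairwise separation is eventually linear,
`D(t) ≥ σ t`, then the `(1 + d^{7/4})`-weighted per-hole remainder `(1 + d^{7/4})·M M'(1/D² + d/D³)` is, for all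
late `t`, at most `ε` uniformly on the cone `0 ≤ d ≤ κ t` (it is `O(t^{-1/4})`).  Brick of the rates block of
crux H′ (card `soft-era-tube-lift`, strategist R4). [folklore] -/
theorem weightedRemainderVanishes : ∀ (M M' σ κ ε : ℝ), 0 ≤ M → 0 ≤ M' → 0 < σ → 0 < κ → 0 < ε → ∀ᶠ t : ℝ in atTop, ∀ d ∈ Set.Icc (0 : ℝ) (κ * t), (1 + Real.sqrt (Real.sqrt (d ^ 7))) * (M * M' * (1 / (σ * t) ^ 2 + d / (σ * t) ^ 3)) ≤ ε := by
  intro M M' σ κ ε hM hM' hσ hκ hε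
  -- the constant of the unweighted bound, made positive
  set K : ℝ := M * M' * (1 / σ ^ 2 + κ / σ ^ 3) + 1 with hK
  have hK0 : 0 ≤ M * M' * (1 / σ ^ 2 + κ / σ ^ 3) := by positivity
  have hKpos : 0 < K := by linarith
  have hKle : M * M' * (1 / σ ^ 2 + κ / σ ^ 3) ≤ K := by linarith
  filter_upwards [eventually_ge_atTop (1 : ℝ), eventually_ge_atTop (2 * K / ε),
    eventually_ge_atTop (κ ^ 7 * (2 * K / ε) ^ 4)] with t ht1 ht2 ht3 d hd
  obtain ⟨hd0, hdκ⟩ := hd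
  have ht : 0 < t := by linarith
  have ht2' : t ≤ t ^ 2 := by nlinarith
  -- unweighted part: `M M' (…) ≤ K / t²`, and `K / t² ≤ ε / 2`
  have hR : M * M' * (1 / (σ * t) ^ 2 + d / (σ * t) ^ 3) ≤ K / t ^ 2 :=
    (remainder_le_div_sq hM hM' hσ ht hd0 hdκ).trans
      (div_le_div_of_nonneg_right hKle (by positivity))
  have hR0 : 0 ≤ M * M' * (1 / (σ * t) ^ 2 + d / (σ * t) ^ 3) := by positivity
  have hKt : K / t ^ 2 ≤ ε / 2 := by
    rw [div_le_div_iff₀ (by positivity) (by norm_num : (0 : ℝ) < 2)]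
    have : 2 * K ≤ ε * t := by
      have := (div_le_iff₀ hε).mp ht2
      linarith
    nlinarith
  -- weight: `√(√(d^7)) ≤ ε t² / (2K)` because `d^7 ≤ (κ t)^7 ≤ (ε t²/(2K))^4` for `t ≥ κ^7 (2K/ε)^4`
  have hz : 0 ≤ ε * t ^ 2 / (2 * K) := by positivity
  have hW : Real.sqrt (Real.sqrt (d ^ 7)) ≤ ε * t ^ 2 / (2 * K) := by
    apply sqrt_sqrt_le_of_le_pow_four hz
    have hκt : 0 ≤ κ * t := by positivity
    calc d ^ 7 ≤ (κ * t) ^ 7 := pow_le_pow_left₀ hd0 hdκ 7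
      _ = κ ^ 7 * t ^ 7 := by ring
      _ ≤ (ε / (2 * K)) ^ 4 * t * t ^ 7 := by
          apply mul_le_mul_of_nonneg_right _ (by positivity)
          have h2K : 0 < 2 * K / ε := by positivity
          have hεK : (ε / (2 * K)) ^ 4 * (2 * K / ε) ^ 4 = 1 := by
            rw [← mul_pow]
            have : ε / (2 * K) * (2 * K / ε) = 1 := by
              field_simp
            rw [this, one_pow]
          calc κ ^ 7 = κ ^ 7 * ((ε / (2 * K)) ^ 4 * (2 * K / ε) ^ 4) := by rw [hεK, mul_one]
            _ = (ε / (2 * K)) ^ 4 * (κ ^ 7 * (2 * K / ε) ^ 4) := by ring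
            _ ≤ (ε / (2 * K)) ^ 4 * t := mul_le_mul_of_nonneg_left ht3 (by positivity)
      _ = (ε * t ^ 2 / (2 * K)) ^ 4 := by ring
  -- assemble: `(1 + W) R ≤ R + W R ≤ ε/2 + (ε t²/(2K)) (K/t²) = ε`
  have hWR : Real.sqrt (Real.sqrt (d ^ 7)) * (M * M' * (1 / (σ * t) ^ 2 + d / (σ * t) ^ 3)) ≤ ε / 2 := by
    calc Real.sqrt (Real.sqrt (d ^ 7)) * (M * M' * (1 / (σ * t) ^ 2 + d / (σ * t) ^ 3))
        ≤ (ε * t ^ 2 / (2 * K)) * (K / t ^ 2) :=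
          mul_le_mul hW hR hR0 hz
      _ = ε / 2 := by
          field_simp
  calc (1 + Real.sqrt (Real.sqrt (d ^ 7))) * (M * M' * (1 / (σ * t) ^ 2 + d / (σ * t) ^ 3))
      = M * M' * (1 / (σ * t) ^ 2 + d / (σ * t) ^ 3) +
          Real.sqrt (Real.sqrt (d ^ 7)) * (M * M' * (1 / (σ * t) ^ 2 + d / (σ * t) ^ 3)) := by ring
    _ ≤ ε / 2 + ε / 2 := add_le_add (hR.trans hKt) hWR
    _ = ε := by ring

end Summit.FinalStateConjecture.FinalStateConjecture.Theorems.EIHFluxBalance.ModulatedKerrHandoffBricks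

end
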